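import Mathlib
import HarnessLib
import Summits.HubbardSuperconductivity.HubbardSuperconductivity.Theorems.KLProgrammeH10TwoPointLimitPerturbedCountThinTolerance
import Summits.HubbardSuperconductivity.HubbardSuperconductivity.Theorems.KLProgrammeH10TwoPointLimitPerturbedCountCooperThin
import Summits.HubbardSuperconductivity.HubbardSuperconductivity.Theorems.KLProgrammeH10TwoPointLimitPerturbedCountPeriodicDeriv

/-!
# Route `KLProgramme` — K3 engine child `KLRegimeEngineV17F2` (stmt-HubbardSuperconductivity-20437), stub (b) import ι₂:
# the THIN anchored pair count on the perturbed curve — reindexing of the near-solution families into the three shift ranges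

Cell gate-hubbard-kl, plan g17 (R41)(i) «E1-P2-THIN-COUNT» (seat p4; assembly, part 1).  The anchored four-leg count reduces (file 5) to grid pairs
`(a, c)` admitting a NEAR-SOLUTION: `(θ₁′, x′, y′)` within `w` of `(θ₁, θ_a, θ_c)` (`θ_i = w/2 + i·w`) with `|h^E_{p_E(θ₁′)}(x′, y′)| ≤ C_r w²`.  This file
re-runs the fibration of BGM App. A2 / Lemma F.1 on that family with PREDICATE-generic reindexing lemmas and converts near-solutions into the thin
tolerances of `…PerturbedCountThinTolerance` in each range:

* generic bookkeeping: `card_filter_prod_le_sum_shift` (pairs ↦ (first index, shift)), `sum_fold_pos_le_of_imp` / `sum_fold_neg_le_of_imp` (the two fold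
  ranges ↦ anti-diagonal rows `(s, j)`), `abs_toIocMod_two_pi_le` (the representative nearest the forward point);
* `nearSol_shift` (near-solutions survive the reindexing), `abs_hfunE_shift_le_fat` (fat tolerance along the shift line),
  **`cooper_filter_card_le`** (Cooper range: near-solution family ⊆ thin affine Cooper family for `|kw − π| ≥ 3w`),
  **`fold_pos_imp`** / **`fold_neg_imp`** (fold ranges: near-solution cell ⇒ thin fold row-cell at `m_s = dist(σ_s − θ₁ − π, 2πℤ)`).

Everything is PROVED; no definitions.  References: BGM 2006 Lemma 3.1 / (2.80) / App. A2–A3 [cite: BenfattoGiulianiMastropietro2006]; Mastropietro 2008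
(14.67) p. 223 [cite: Mastropietro2008].
-/

noncomputable section

namespace Summit.HubbardSuperconductivity.HubbardSuperconductivity.Theorems.PerturbedFermiCurve

set_option linter.dupNamespace false -- summit = problem name (single-conjunct summit), D-0017

open Real Set
open Literature.MathematicalPhysics.QuantumLattice Literature.MathematicalPhysics.QuantumLattice.BandSectorCounting

/-! ## §1 Predicate-generic reindexing -/

/-- **Pairs ↦ (first index, shift)**: if `Q a c ⇒ Q′ a k` with `k = c − a (mod N)`, then `#{(a,c) ∈ [0,N)² : Q} ≤ Σ_{k<N} #{i<N : Q′ i k}`. [folklore] -/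
theorem card_filter_prod_le_sum_shift {N : ℕ} (Q Q' : ℕ → ℕ → Prop) [DecidablePred fun p : ℕ × ℕ => Q p.1 p.2]
    [∀ k, DecidablePred fun i => Q' i k]
    (hQQ' : ∀ a c, a < N → c < N → Q a c → Q' a (if a ≤ c then c - a else c + N - a)) :
    ((((Finset.range N ×ˢ Finset.range N).filter fun p : ℕ × ℕ => Q p.1 p.2).card : ℝ)) ≤
      ∑ k ∈ Finset.range N, ((((Finset.range N).filter fun i : ℕ => Q' i k).card : ℝ)) := by
  rw [← card_filter_prod_eq_sum' N (fun i k => Q' i k)]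
  norm_cast
  refine Finset.card_le_card_of_injOn (fun p : ℕ × ℕ => (p.1, if p.1 ≤ p.2 then p.2 - p.1 else p.2 + N - p.1)) ?_ ?_
  · intro p hp
    rw [Finset.mem_coe, Finset.mem_filter, Finset.mem_product, Finset.mem_range, Finset.mem_range] at hp
    obtain ⟨⟨ha, hc⟩, hQ⟩ := hp
    rw [Finset.mem_coe, Finset.mem_filter, Finset.mem_product, Finset.mem_range, Finset.mem_range]
    dsimp only
    refine ⟨⟨ha, ?_⟩, hQQ' p.1 p.2 ha hc hQ⟩
    split_ifs <;> omega
  · intro p hp q hq hpq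
    rw [Finset.mem_coe, Finset.mem_filter, Finset.mem_product, Finset.mem_range, Finset.mem_range] at hp hq
    simp only [Prod.mk.injEq] at hpq
    obtain ⟨h1', h2'⟩ := hpq
    have : p.2 = q.2 := by
      split_ifs at h2' <;> omega
    exact Prod.ext h1' this

/-- **The fold range `0 < kw ≤ τ` ↦ anti-diagonal rows** `(i, k) ↦ (s, j) = (2i + k, k − 1)` (`σ_s = w/2 + s·w/2`, `t_j = (j+1)w = kw`): for predicates with
`Q′ i k ⇒ R (2i + k) (k − 1)` (`1 ≤ k`, `kw ≤ τ`), `Σ_{kw ≤ τ} #{i : Q′ i k} ≤ N + Σ_{s<4N} #{j < ⌊τ/w⌋ : R s j}` (the shift `k = 0` costs `≤ N`). [folklore] -/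
theorem sum_fold_pos_le_of_imp {N : ℕ} {w τ : ℝ} (hw : 0 < w) (Q' R : ℕ → ℕ → Prop) [∀ k, DecidablePred fun i => Q' i k]
    [∀ s, DecidablePred fun j => R s j]
    (hQR : ∀ i k, i < N → 1 ≤ k → k < N → (k : ℝ) * w ≤ τ → Q' i k → R (2 * i + k) (k - 1)) :
    ∑ k ∈ (Finset.range N).filter (fun k : ℕ => (k : ℝ) * w ≤ τ), ((((Finset.range N).filter fun i : ℕ => Q' i k).card : ℝ)) ≤
      N + ∑ s ∈ Finset.range (4 * N), ((((Finset.range ⌊τ / w⌋₊).filter fun j : ℕ => R s j).card : ℝ)) := by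
  set S := (Finset.range N).filter (fun k : ℕ => (k : ℝ) * w ≤ τ) with hS
  set f : ℕ → ℝ := fun k => ((((Finset.range N).filter fun i : ℕ => Q' i k).card : ℝ)) with hf
  have hfN : ∀ k, f k ≤ N := by
    intro k
    rw [hf]; dsimp only
    have := Finset.card_filter_le (Finset.range N) (fun i : ℕ => Q' i k)
    rw [Finset.card_range] at this
    exact_mod_cast this
  have hf0 : ∀ k, 0 ≤ f k := fun k => by positivity
  rw [← Finset.sum_filter_add_sum_filter_not S (fun k : ℕ => k = 0)]
  have h0 : ∑ k ∈ S.filter (fun k : ℕ => k = 0), f k ≤ N := by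
    have hsub : S.filter (fun k : ℕ => k = 0) ⊆ {0} := by
      intro k hk; rw [Finset.mem_filter] at hk; rw [Finset.mem_singleton]; exact hk.2
    calc ∑ k ∈ S.filter (fun k : ℕ => k = 0), f k ≤ ∑ k ∈ ({0} : Finset ℕ), f k :=
          Finset.sum_le_sum_of_subset_of_nonneg hsub fun k _ _ => hf0 k
      _ = f 0 := Finset.sum_singleton _ _
      _ ≤ N := hfN 0
  have hpos : ∑ k ∈ S.filter (fun k : ℕ => ¬ k = 0), f k ≤
      ∑ s ∈ Finset.range (4 * N), ((((Finset.range ⌊τ / w⌋₊).filter fun j : ℕ => R s j).card : ℝ)) := by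
    rw [hf]
    rw [← card_filter_product_eq_sum_snd (Finset.range N) (S.filter (fun k : ℕ => ¬ k = 0)) (fun i k => Q' i k),
      ← card_filter_product_eq_sum_fst (Finset.range (4 * N)) (Finset.range ⌊τ / w⌋₊) (fun s j => R s j)]
    norm_cast
    refine Finset.card_le_card_of_injOn (fun p : ℕ × ℕ => (2 * p.1 + p.2, p.2 - 1)) ?_ ?_
    · intro p hp
      rw [Finset.mem_coe, Finset.mem_filter, Finset.mem_product, Finset.mem_range, Finset.mem_filter, hS,
        Finset.mem_filter, Finset.mem_range] at hp
      obtain ⟨⟨ha, ⟨hkN, hkτ⟩, hk0⟩, hQ⟩ := hp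
      have hk1 : 1 ≤ p.2 := Nat.one_le_iff_ne_zero.2 hk0
      rw [Finset.mem_coe, Finset.mem_filter, Finset.mem_product, Finset.mem_range, Finset.mem_range]
      dsimp only
      refine ⟨⟨by omega, ?_⟩, hQR p.1 p.2 ha hk1 hkN hkτ hQ⟩
      have : p.2 ≤ ⌊τ / w⌋₊ := by
        rw [Nat.le_floor_iff (by
          have : (0:ℝ) ≤ p.2 * w := by positivity
          exact div_nonneg (this.trans hkτ) hw.le)]
        rw [le_div_iff₀ hw]; exact hkτ
      omega
    · intro p hp q hq hpq
      rw [Finset.mem_coe, Finset.mem_filter, Finset.mem_product, Finset.mem_filter, hS, Finset.mem_filter] at hp hq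
      simp only [Prod.mk.injEq] at hpq
      have hp1 : 1 ≤ p.2 := Nat.one_le_iff_ne_zero.2 hp.1.2.2
      have hq1 : 1 ≤ q.2 := Nat.one_le_iff_ne_zero.2 hq.1.2.2
      have h2 : p.2 = q.2 := by omega
      have h1 : p.1 = q.1 := by omega
      exact Prod.ext h1 h2
  linarith

/-- **The fold range `kw ≥ 2π − τ` ↦ anti-diagonal rows** `(i, k) ↦ (2i + N + k, N − k − 1)`: for predicates with `Q′ i k ⇒ R (2i + N + k) (N − k − 1)`
(`2π − τ ≤ kw`), `Σ_{kw ≥ 2π−τ} #{i : Q′ i k} ≤ Σ_{s<4N} #{j < ⌊τ/w⌋ : R s j}`. [folklore] -/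
theorem sum_fold_neg_le_of_imp {N : ℕ} {w τ : ℝ} (hw : 0 < w) (hN : (N : ℝ) * w = 2 * π) (Q' R : ℕ → ℕ → Prop)
    [∀ k, DecidablePred fun i => Q' i k] [∀ s, DecidablePred fun j => R s j]
    (hQR : ∀ i k, i < N → k < N → 2 * π - τ ≤ (k : ℝ) * w → Q' i k → R (2 * i + N + k) (N - k - 1)) :
    ∑ k ∈ (Finset.range N).filter (fun k : ℕ => 2 * π - τ ≤ (k : ℝ) * w), ((((Finset.range N).filter fun i : ℕ => Q' i k).card : ℝ)) ≤
      ∑ s ∈ Finset.range (4 * N), ((((Finset.range ⌊τ / w⌋₊).filter fun j : ℕ => R s j).card : ℝ)) := by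
  set S := (Finset.range N).filter (fun k : ℕ => 2 * π - τ ≤ (k : ℝ) * w) with hS
  rw [← card_filter_product_eq_sum_snd (Finset.range N) S (fun i k => Q' i k),
    ← card_filter_product_eq_sum_fst (Finset.range (4 * N)) (Finset.range ⌊τ / w⌋₊) (fun s j => R s j)]
  norm_cast
  refine Finset.card_le_card_of_injOn (fun p : ℕ × ℕ => (2 * p.1 + N + p.2, N - p.2 - 1)) ?_ ?_
  · intro p hp
    rw [Finset.mem_coe, Finset.mem_filter, Finset.mem_product, Finset.mem_range, hS, Finset.mem_filter,
      Finset.mem_range] at hp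
    obtain ⟨⟨ha, ⟨hkN, hkτ⟩⟩, hQ⟩ := hp
    rw [Finset.mem_coe, Finset.mem_filter, Finset.mem_product, Finset.mem_range, Finset.mem_range]
    dsimp only
    refine ⟨⟨by omega, ?_⟩, hQR p.1 p.2 ha hkN hkτ hQ⟩
    have hle : ((N - p.2 : ℕ) : ℝ) * w ≤ τ := by
      rw [Nat.cast_sub hkN.le, sub_mul, hN]; linarith
    have : N - p.2 ≤ ⌊τ / w⌋₊ := by
      rw [Nat.le_floor_iff (div_nonneg ((by positivity : (0:ℝ) ≤ ((N - p.2 : ℕ) : ℝ) * w).trans hle) hw.le),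
        le_div_iff₀ hw]
      exact hle
    omega
  · intro p hp q hq hpq
    rw [Finset.mem_coe, Finset.mem_filter, Finset.mem_product, Finset.mem_range, hS, Finset.mem_filter,
      Finset.mem_range] at hp hq
    simp only [Prod.mk.injEq] at hpq
    have hp1 := hp.1.2.1; have hq1 := hq.1.2.1
    have h2 : p.2 = q.2 := by omega
    have h1 : p.1 = q.1 := by omega
    exact Prod.ext h1 h2

/-- **The representative nearest to `0` is the nearest**: `|toIocMod 2π (−π) x| ≤ |x − k·2π|` for every integer `k`. [folklore] -/
theorem abs_toIocMod_two_pi_le (x : ℝ) (k : ℤ) : |toIocMod Real.two_pi_pos (-π) x| ≤ |x - k * (2 * π)| := by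
  have hπ := Real.pi_pos
  have hmem := toIocMod_mem_Ioc Real.two_pi_pos (-π) x
  set z := toIocMod Real.two_pi_pos (-π) x with hz
  have hzle : |z| ≤ π := by rw [abs_le]; constructor <;> linarith [hmem.1, hmem.2]
  set n := toIocDiv Real.two_pi_pos (-π) x with hn
  have hx : x = z + n * (2 * π) := by
    have := self_sub_toIocDiv_zsmul Real.two_pi_pos (-π) x
    rw [← hn, ← hz, zsmul_eq_mul] at this; linarith
  have e : x - k * (2 * π) = z + ((n - k : ℤ) : ℝ) * (2 * π) := by rw [hx]; push_cast; ring
  rw [e]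
  rcases eq_or_ne (n - k) 0 with h0 | h0
  · rw [h0]; simp
  · have h1 : (1 : ℝ) ≤ |((n - k : ℤ) : ℝ)| := by rw [← Int.cast_abs]; exact_mod_cast Int.one_le_abs h0
    have h2 : 2 * π ≤ |((n - k : ℤ) : ℝ) * (2 * π)| := by
      rw [abs_mul, abs_of_pos Real.two_pi_pos]; nlinarith
    have h3 := abs_sub_abs_le_abs_sub (((n - k : ℤ) : ℝ) * (2 * π)) (-z)
    rw [sub_neg_eq_add, add_comm, abs_neg] at h3
    linarith

/-- `0 ≤ |toIocMod 2π (−π) x| ≤ π`. [folklore] -/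
theorem abs_toIocMod_two_pi_le_pi (x : ℝ) : |toIocMod Real.two_pi_pos (-π) x| ≤ π := by
  have hmem := toIocMod_mem_Ioc Real.two_pi_pos (-π) x
  rw [abs_le]; constructor <;> linarith [hmem.1, hmem.2]

/-! ## §2 The near-solution families in the three ranges -/

section Ranges

variable {a b : ℝ} (B : BandBounds a b) {δ : (Fin 2 → ℝ) → ℝ} (hδs : ContDiff ℝ 2 δ) (heven : ∀ k, δ (-k) = δ k)
  {κ₀ κ₁ κ₂ μ : ℝ} (hδ : ∀ k : Fin 2 → ℝ, |δ k| ≤ κ₀) (hlo : a ≤ μ - κ₀) (hhi : μ + κ₀ ≤ b)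
  (hκ : ∀ k : Fin 2 → ℝ, ‖fderiv ℝ δ k‖ ≤ κ₁) (hκ₁ : κ₁ < B.Dtmin) (hκ₂ : ∀ k : Fin 2 → ℝ, ‖fderiv ℝ (fderiv ℝ δ) k‖ ≤ κ₂)
  {u : ℝ → ℝ} (hu : ∀ θ, IsBandFermiRadius (μ - δ (u θ • dir θ)) θ (u θ))

include B hδs hδ hlo hhi hκ hκ₁ hu in
/-- **Near-solutions survive the reindexing by the shift** (periodicity of `h^E` in the third leg). [folklore] -/
theorem nearSol_shift {θ₁ w Cr : ℝ} {N : ℕ} (hN : (N : ℝ) * w = 2 * π) {a c : ℕ} (ha : a < N)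
    (h : ∃ θ₁' x' y' : ℝ, |θ₁ - θ₁'| ≤ w ∧ |w / 2 + a * w - x'| ≤ w ∧ |w / 2 + c * w - y'| ≤ w ∧
      |hfunE δ u μ (XE u θ₁', YE u θ₁') x' y'| ≤ Cr * w ^ 2) :
    ∃ θ₁' x' y' : ℝ, |θ₁ - θ₁'| ≤ w ∧ |w / 2 + a * w - x'| ≤ w ∧
      |w / 2 + a * w + ((if a ≤ c then c - a else c + N - a : ℕ) : ℝ) * w - y'| ≤ w ∧ |hfunE δ u μ (XE u θ₁', YE u θ₁') x' y'| ≤ Cr * w ^ 2 := by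
  obtain ⟨θ₁', x', y', h1, h2, h3, h4⟩ := h
  split_ifs with hle
  · refine ⟨θ₁', x', y', h1, h2, ?_, h4⟩
    have e : w / 2 + (a : ℝ) * w + ((c - a : ℕ) : ℝ) * w = w / 2 + c * w := by rw [Nat.cast_sub hle]; ring
    rw [e]; exact h3
  · push Not at hle
    refine ⟨θ₁', x', y' + (1 : ℤ) * (2 * π), h1, h2, ?_, ?_⟩
    · have e : w / 2 + (a : ℝ) * w + ((c + N - a : ℕ) : ℝ) * w - (y' + (1 : ℤ) * (2 * π)) = w / 2 + c * w - y' := by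
        rw [Nat.cast_sub (by omega : a ≤ c + N)]; push_cast; rw [← hN]; ring
      rw [e]; exact h3
    · rw [hfunE_add_int_mul_two_pi_three B hδs hδ hlo hhi hκ hκ₁ hu]; exact h4

include B hδs hδ hlo hhi hκ hκ₁ hu in
/-- **Fat tolerance along a shift line** from a near-solution: `|h^E_{p_E(θ₁)}(θ_i, θ_i + kw)| ≤ C_r w² + 3(4+κ₁)S_E·w`. [cite: BenfattoGiulianiMastropietro2006, Lemma 3.1] -/
theorem abs_hfunE_shift_le_fat {θ₁ w Cr x y : ℝ}
    (h : ∃ θ₁' x' y' : ℝ, |θ₁ - θ₁'| ≤ w ∧ |x - x'| ≤ w ∧ |y - y'| ≤ w ∧ |hfunE δ u μ (XE u θ₁', YE u θ₁') x' y'| ≤ Cr * w ^ 2) :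
    |hfunE δ u μ (XE u θ₁, YE u θ₁) x y| ≤ Cr * w ^ 2 + 3 * ((4 + κ₁) * pcSE B κ₁) * w := by
  obtain ⟨θ₁', x', y', h1, h2, h3, h4⟩ := h
  exact abs_hfunE_le_fat B hδs hδ hlo hhi hκ hκ₁ hu h4 h1 h2 h3

include B hδs heven hδ hlo hhi hκ hκ₁ hκ₂ hu

open Classical in
/-- **Cooper range**: for a shift with `3w ≤ |kw − π|`, every near-solution cell of the line `θ₃ = θ₂ + kw` lies in the thin affine Cooper family
`|h^E| ≤ C_c w² + K₁ w |kw − π|`, `C_c = 3C_r + 2K₁ + K₂` (`d₀ = 1`). [cite: BenfattoGiulianiMastropietro2006, Lemma 3.1 / (2.80)] -/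
theorem cooper_filter_card_le {θ₁ w Cr lam : ℝ} (hw : 0 < w) {N k : ℕ} (hk : 3 * w ≤ |(k : ℝ) * w - π|) :
    ((((Finset.range N).filter fun i : ℕ =>
        (∃ θ₁' x' y' : ℝ, |θ₁ - θ₁'| ≤ w ∧ |w / 2 + i * w - x'| ≤ w ∧ |w / 2 + i * w + k * w - y'| ≤ w ∧
          |hfunE δ u μ (XE u θ₁', YE u θ₁') x' y'| ≤ Cr * w ^ 2) ∧
        |h3E δ u (XE u θ₁, YE u θ₁) (w / 2 + i * w) (w / 2 + i * w + k * w)| < lam ∧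
        |h3E δ u (XE u θ₁, YE u θ₁) (w / 2 + i * w + k * w) (w / 2 + i * w)| < lam).card : ℝ)) ≤
      ((((Finset.range N).filter fun i : ℕ =>
        |hfunE δ u μ (XE u θ₁, YE u θ₁) (w / 2 + i * w) (w / 2 + i * w + k * w)| ≤
            (Cr + 2 * Cr / 1 + 2 * (5 * ((4 + κ₂) * pcSE B κ₁ ^ 2) + 3 * ((4 + κ₁) * pcAE B κ₁ κ₂)) +
              (8 * ((4 + κ₂) * pcSE B κ₁ ^ 2) + 2 * ((4 + κ₁) * pcAE B κ₁ κ₂))) * w ^ 2 +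
          (5 * ((4 + κ₂) * pcSE B κ₁ ^ 2) + 3 * ((4 + κ₁) * pcAE B κ₁ κ₂)) * w * |(k : ℝ) * w - π| ∧
        |h3E δ u (XE u θ₁, YE u θ₁) (w / 2 + i * w) (w / 2 + i * w + k * w)| < lam ∧
        |h3E δ u (XE u θ₁, YE u θ₁) (w / 2 + i * w + k * w) (w / 2 + i * w)| < lam).card : ℝ)) := by
  refine Nat.cast_le.2 (Finset.card_le_card (Finset.monotone_filter_right _ fun i _ hi => ?_))
  obtain ⟨⟨θ₁', x', y', h1, h2, h3, h4⟩, hp1, hp2⟩ := hi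
  refine ⟨?_, hp1, hp2⟩
  have hd : 1 * w ≤ |y' - x' - π| := by
    have e : y' - x' - π = ((k : ℝ) * w - π) - (w / 2 + i * w + k * w - y') + (w / 2 + i * w - x') := by ring
    rw [e]
    have t1 := abs_sub_abs_le_abs_sub ((k : ℝ) * w - π) (w / 2 + i * w + k * w - y')
    have t2 := abs_sub_abs_le_abs_sub (((k : ℝ) * w - π) - (w / 2 + i * w + k * w - y')) (-(w / 2 + i * w - x'))
    rw [sub_neg_eq_add, abs_neg] at t2
    linarith
  have h := abs_hfunE_le_thin_cooper B hδs heven hδ hlo hhi hκ hκ₁ hκ₂ hu (θ₁ := θ₁) (x := w / 2 + i * w) (c := (k : ℝ) * w)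
    h4 hw le_rfl le_rfl one_pos hd h1 h2 h3
  exact h

/-- **Fold range `0 < kw ≤ τ`**: a near-solution cell of the line `θ₃ = θ₂ + kw` is a thin fold cell of the row `s = 2i + k`, `t = kw`, at the
representative `m_s = |toIocMod 2π (−π) (σ_s − θ₁ − π)|` of the distance to the forward point. [cite: BenfattoGiulianiMastropietro2006, Lemma 3.1 / App. A2] -/
theorem fold_pos_imp {θ₁ w Cr lam : ℝ} (hw : 0 < w) (i k : ℕ) (hk1 : 1 ≤ k)
    (hQ : (∃ θ₁' x' y' : ℝ, |θ₁ - θ₁'| ≤ w ∧ |w / 2 + i * w - x'| ≤ w ∧ |w / 2 + i * w + k * w - y'| ≤ w ∧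
          |hfunE δ u μ (XE u θ₁', YE u θ₁') x' y'| ≤ Cr * w ^ 2) ∧
        |h3E δ u (XE u θ₁, YE u θ₁) (w / 2 + i * w) (w / 2 + i * w + k * w)| < lam ∧
        |h3E δ u (XE u θ₁, YE u θ₁) (w / 2 + i * w + k * w) (w / 2 + i * w)| < lam) :
    |hfunE δ u μ (XE u θ₁, YE u θ₁) (w / 2 + (2 * i + k : ℕ) * (w / 2) - (w + (k - 1 : ℕ) * w) / 2)
        (w / 2 + (2 * i + k : ℕ) * (w / 2) + (w + (k - 1 : ℕ) * w) / 2)| ≤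
      ((Cr + 8 * (3 * ((4 + κ₂) * pcSE B κ₁ ^ 2) + 2 * ((4 + κ₁) * pcAE B κ₁ κ₂))) * w ^ 2 +
        2 * (3 * ((4 + κ₂) * pcSE B κ₁ ^ 2) + 2 * ((4 + κ₁) * pcAE B κ₁ κ₂)) * w *
          |toIocMod Real.two_pi_pos (-π) (w / 2 + (2 * i + k : ℕ) * (w / 2) - θ₁ - π)|) +
        (3 * ((4 + κ₂) * pcSE B κ₁ ^ 2) + 2 * ((4 + κ₁) * pcAE B κ₁ κ₂)) * w * (w + (k - 1 : ℕ) * w) ∧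
    |h3E δ u (XE u θ₁, YE u θ₁) (w / 2 + (2 * i + k : ℕ) * (w / 2) + (w + (k - 1 : ℕ) * w) / 2) (w / 2 + (2 * i + k : ℕ) * (w / 2) - (w + (k - 1 : ℕ) * w) / 2) +
      h3E δ u (XE u θ₁, YE u θ₁) (w / 2 + (2 * i + k : ℕ) * (w / 2) - (w + (k - 1 : ℕ) * w) / 2) (w / 2 + (2 * i + k : ℕ) * (w / 2) + (w + (k - 1 : ℕ) * w) / 2)| ≤
        2 * lam := by
  obtain ⟨⟨θ₁', x', y', h1, h2, h3, h4⟩, hp1, hp2⟩ := hQ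
  set σ := w / 2 + (2 * i + k : ℕ) * (w / 2) with hσdef
  set t := w + (k - 1 : ℕ) * w with htdef
  have et : t = (k : ℝ) * w := by rw [htdef, Nat.cast_sub hk1]; push_cast; ring
  have e1 : σ - t / 2 = w / 2 + i * w := by rw [hσdef, et]; push_cast; ring
  have e2 : σ + t / 2 = w / 2 + i * w + k * w := by rw [hσdef, et]; push_cast; ring
  have ht0 : 0 ≤ t := by rw [et]; positivity
  refine ⟨?_, ?_⟩
  · -- the representative nearest to the forward point
    set n := toIocDiv Real.two_pi_pos (-π) (σ - θ₁ - π) with hn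
    set σ' := σ - n * (2 * π) with hσ'
    have hrep : σ' - θ₁ - π = toIocMod Real.two_pi_pos (-π) (σ - θ₁ - π) := by
      have := self_sub_toIocDiv_zsmul Real.two_pi_pos (-π) (σ - θ₁ - π)
      rw [← hn, zsmul_eq_mul] at this; rw [hσ']; linarith
    have hper2 : hfunE δ u μ (XE u θ₁, YE u θ₁) (σ - t / 2) (σ + t / 2) = hfunE δ u μ (XE u θ₁, YE u θ₁) (σ' - t / 2) (σ' + t / 2) := by
      have ea : σ - t / 2 = (σ' - t / 2) + n * (2 * π) := by rw [hσ']; ring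
      have eb : σ + t / 2 = (σ' + t / 2) + n * (2 * π) := by rw [hσ']; ring
      rw [ea, eb, hfunE_add_int_mul_two_pi_two B hδs hδ hlo hhi hκ hκ₁ hu, hfunE_add_int_mul_two_pi_three B hδs hδ hlo hhi hκ hκ₁ hu]
    have h4' : |hfunE δ u μ (XE u θ₁', YE u θ₁') (x' - n * (2 * π)) (y' - n * (2 * π))| ≤ Cr * w ^ 2 := by
      have ea : x' = (x' - n * (2 * π)) + n * (2 * π) := by ring
      have eb : y' = (y' - n * (2 * π)) + n * (2 * π) := by ring
      rw [ea, eb, hfunE_add_int_mul_two_pi_two B hδs hδ hlo hhi hκ hκ₁ hu, hfunE_add_int_mul_two_pi_three B hδs hδ hlo hhi hκ hκ₁ hu] at h4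
      exact h4
    have h2' : |σ' - t / 2 - (x' - n * (2 * π))| ≤ w := by
      rw [show σ' - t / 2 - (x' - n * (2 * π)) = (σ - t / 2) - x' by rw [hσ']; ring, e1]; exact h2
    have h3' : |σ' + t / 2 - (y' - n * (2 * π))| ≤ w := by
      rw [show σ' + t / 2 - (y' - n * (2 * π)) = (σ + t / 2) - y' by rw [hσ']; ring, e2]; exact h3
    have h := abs_hfunE_le_thin_fold B hδs heven hδ hlo hhi hκ hκ₁ hκ₂ hu (θ₁ := θ₁) (σ := σ') (t := t) h4' hw le_rfl le_rfl ht0 h1 h2' h3'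
    rw [← hper2, hrep] at h
    exact h
  · rw [e1, e2]
    calc _ ≤ |h3E δ u (XE u θ₁, YE u θ₁) (w / 2 + i * w + k * w) (w / 2 + i * w)| +
          |h3E δ u (XE u θ₁, YE u θ₁) (w / 2 + i * w) (w / 2 + i * w + k * w)| := abs_add_le _ _
      _ ≤ 2 * lam := by linarith

/-- **Fold range `kw ≥ 2π − τ`**: a near-solution cell of the line `θ₃ = θ₂ + kw` is a thin fold cell of the row `s = 2i + N + k`, `t = (N − k)w`.
[cite: BenfattoGiulianiMastropietro2006, Lemma 3.1 / App. A2] -/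
theorem fold_neg_imp {θ₁ w Cr lam : ℝ} (hw : 0 < w) {N : ℕ} (hN : (N : ℝ) * w = 2 * π) (i k : ℕ) (hkN : k < N)
    (hQ : (∃ θ₁' x' y' : ℝ, |θ₁ - θ₁'| ≤ w ∧ |w / 2 + i * w - x'| ≤ w ∧ |w / 2 + i * w + k * w - y'| ≤ w ∧
          |hfunE δ u μ (XE u θ₁', YE u θ₁') x' y'| ≤ Cr * w ^ 2) ∧
        |h3E δ u (XE u θ₁, YE u θ₁) (w / 2 + i * w) (w / 2 + i * w + k * w)| < lam ∧
        |h3E δ u (XE u θ₁, YE u θ₁) (w / 2 + i * w + k * w) (w / 2 + i * w)| < lam) :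
    |hfunE δ u μ (XE u θ₁, YE u θ₁) (w / 2 + (2 * i + N + k : ℕ) * (w / 2) - (w + (N - k - 1 : ℕ) * w) / 2)
        (w / 2 + (2 * i + N + k : ℕ) * (w / 2) + (w + (N - k - 1 : ℕ) * w) / 2)| ≤
      ((Cr + 8 * (3 * ((4 + κ₂) * pcSE B κ₁ ^ 2) + 2 * ((4 + κ₁) * pcAE B κ₁ κ₂))) * w ^ 2 +
        2 * (3 * ((4 + κ₂) * pcSE B κ₁ ^ 2) + 2 * ((4 + κ₁) * pcAE B κ₁ κ₂)) * w *
          |toIocMod Real.two_pi_pos (-π) (w / 2 + (2 * i + N + k : ℕ) * (w / 2) - θ₁ - π)|) +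
        (3 * ((4 + κ₂) * pcSE B κ₁ ^ 2) + 2 * ((4 + κ₁) * pcAE B κ₁ κ₂)) * w * (w + (N - k - 1 : ℕ) * w) ∧
    |h3E δ u (XE u θ₁, YE u θ₁) (w / 2 + (2 * i + N + k : ℕ) * (w / 2) + (w + (N - k - 1 : ℕ) * w) / 2)
        (w / 2 + (2 * i + N + k : ℕ) * (w / 2) - (w + (N - k - 1 : ℕ) * w) / 2) +
      h3E δ u (XE u θ₁, YE u θ₁) (w / 2 + (2 * i + N + k : ℕ) * (w / 2) - (w + (N - k - 1 : ℕ) * w) / 2)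
        (w / 2 + (2 * i + N + k : ℕ) * (w / 2) + (w + (N - k - 1 : ℕ) * w) / 2)| ≤ 2 * lam := by
  obtain ⟨⟨θ₁', x', y', h1, h2, h3, h4⟩, hp1, hp2⟩ := hQ
  set σ := w / 2 + (2 * i + N + k : ℕ) * (w / 2) with hσdef
  set t := w + (N - k - 1 : ℕ) * w with htdef
  have ec : ((N - k - 1 : ℕ) : ℝ) = (N : ℝ) - k - 1 := by
    rw [Nat.cast_sub (by omega : 1 ≤ N - k), Nat.cast_sub hkN.le]; push_cast; ring
  have et : t = 2 * π - (k : ℝ) * w := by rw [htdef, ec, ← hN]; ring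
  have e1 : σ - t / 2 = w / 2 + i * w + k * w := by rw [hσdef, et]; push_cast; rw [← hN]; ring
  have e2 : σ + t / 2 = w / 2 + i * w + (1 : ℤ) * (2 * π) := by rw [hσdef, et]; push_cast; rw [← hN]; ring
  have ht0 : 0 ≤ t := by
    rw [et]
    have : (k : ℝ) * w ≤ N * w := mul_le_mul_of_nonneg_right (by exact_mod_cast hkN.le) hw.le
    linarith
  refine ⟨?_, ?_⟩
  · set n := toIocDiv Real.two_pi_pos (-π) (σ - θ₁ - π) with hn
    set σ' := σ - n * (2 * π) with hσ'
    have hrep : σ' - θ₁ - π = toIocMod Real.two_pi_pos (-π) (σ - θ₁ - π) := by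
      have := self_sub_toIocDiv_zsmul Real.two_pi_pos (-π) (σ - θ₁ - π)
      rw [← hn, zsmul_eq_mul] at this; rw [hσ']; linarith
    have hper2 : hfunE δ u μ (XE u θ₁, YE u θ₁) (σ - t / 2) (σ + t / 2) = hfunE δ u μ (XE u θ₁, YE u θ₁) (σ' - t / 2) (σ' + t / 2) := by
      have ea : σ - t / 2 = (σ' - t / 2) + n * (2 * π) := by rw [hσ']; ring
      have eb : σ + t / 2 = (σ' + t / 2) + n * (2 * π) := by rw [hσ']; ring
      rw [ea, eb, hfunE_add_int_mul_two_pi_two B hδs hδ hlo hhi hκ hκ₁ hu, hfunE_add_int_mul_two_pi_three B hδs hδ hlo hhi hκ hκ₁ hu]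
    -- witnesses: `a″ = y′ − 2πn` (near `σ′ − t/2`), `c″ = x′ + 2π − 2πn` (near `σ′ + t/2`)
    have h4' : |hfunE δ u μ (XE u θ₁', YE u θ₁') (y' - n * (2 * π)) (x' + (1 : ℤ) * (2 * π) - n * (2 * π))| ≤ Cr * w ^ 2 := by
      have ea : y' - n * (2 * π) = y' + (-n : ℤ) * (2 * π) := by push_cast; ring
      have eb : x' + (1 : ℤ) * (2 * π) - n * (2 * π) = x' + ((1 - n : ℤ)) * (2 * π) := by push_cast; ring
      rw [ea, eb, hfunE_add_int_mul_two_pi_two B hδs hδ hlo hhi hκ hκ₁ hu, hfunE_add_int_mul_two_pi_three B hδs hδ hlo hhi hκ hκ₁ hu,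
        hfunE_swap]
      exact h4
    have h2' : |σ' - t / 2 - (y' - n * (2 * π))| ≤ w := by
      rw [show σ' - t / 2 - (y' - n * (2 * π)) = (σ - t / 2) - y' by rw [hσ']; ring, e1]; exact h3
    have h3' : |σ' + t / 2 - (x' + (1 : ℤ) * (2 * π) - n * (2 * π))| ≤ w := by
      rw [show σ' + t / 2 - (x' + (1 : ℤ) * (2 * π) - n * (2 * π)) = (σ + t / 2) - (1 : ℤ) * (2 * π) - x' by rw [hσ']; ring, e2]
      rw [show w / 2 + (i : ℝ) * w + (1 : ℤ) * (2 * π) - (1 : ℤ) * (2 * π) - x' = w / 2 + i * w - x' by ring]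
      exact h2
    have h := abs_hfunE_le_thin_fold B hδs heven hδ hlo hhi hκ hκ₁ hκ₂ hu (θ₁ := θ₁) (σ := σ') (t := t) h4' hw le_rfl le_rfl ht0 h1 h2' h3'
    rw [← hper2, hrep] at h
    exact h
  · rw [e1, e2, h3E_add_int_mul_two_pi_two B hδs hδ hlo hhi hκ hκ₁ hu, h3E_add_int_mul_two_pi_three B hδs hδ hlo hhi hκ hκ₁ hu]
    calc _ ≤ |h3E δ u (XE u θ₁, YE u θ₁) (w / 2 + i * w) (w / 2 + i * w + k * w)| +
          |h3E δ u (XE u θ₁, YE u θ₁) (w / 2 + i * w + k * w) (w / 2 + i * w)| := abs_add_le _ _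
      _ ≤ 2 * lam := by linarith

end Ranges

end Summit.HubbardSuperconductivity.HubbardSuperconductivity.Theorems.PerturbedFermiCurve

end
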